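import Summits.HodgeConjecture.HodgeConjecture.Theorems.F0P3SpectralPacketCoherent   -- ★ (N) FILE 3v p844063 (this seat): `CohPacketG`, `XiPacketsSignedCoh`, `piXiC`, Q-generic `IsSignedPacketOf.*`, (L1′) `XiRigidityGCoh` (+ ★ 3s, 3q, 3f, 3a, 3b)
import HarnessLib

/-!
# (N) DEFS, FILE 3w — THE TYPE-HOMOGENEOUS PACKETS: `HomogPacketG = {Q // Q.inf = infOf Q.fin ∧ Q.fin.IsHomogeneous aTok}` (REF1∕ref1 OBJECTION o384-1: print's `Π(G) = Π_a ⊔ Π_e ⊔ Π_s`, not the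
# literal «some member is discrete» families), the A-marked coherent signed ξ-shape, (L1″) `XiRigidityGHom`, and the `G`-germ sum over the homogeneous index
# (Rogawski §13.3 p. 201 ll. 10–18, Thm. 13.3.5, Thm. 13.3.6 (c) p. 202, p. 199 l. −2; §14.6 (14.6.1)–(14.6.3) pp. 240–243)

Cell `hodgecm-mathlib` (D-0151), F0∕P3 «U3-mult», crux H413 (`stmt-HodgeConjecture-24833`), route of record `HCCMUnconditional`.  (N) lead pen F0P3a-p01 (g13); ref1 (g9) R1-384 OBJECTION
**o384-1**, REPRODUCED by REF1 (g22) m08 (kernel probes b4b8ac01ca367d6f ∕ 104b681ebac54e19: (L1′) `XiRigidityGCoh` at one honest `(ξ, S)` forbids every swapped family `Π(ξ)[w ↦ P₂]`, `w ∈ S`, from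
having a member in `L²_d(μ)` — print-false for the hybrid `P₂ = ξ_H(St_H(ξ_w))`, whose member `πˢ(ξ_w) ⊗ πˢ(ξ_{w′}) ⊗ ⊗πⁿ` is cuspidal with `m = 1` [Thm. 13.3.7]); desk F0P3-plan (g9) RULING D33 (3′)
(the TUPLE edition «K9STF ⟸ TUPLE» waits for this repair; acceptance test = REF1 m08 (n8-2) (i)–(iii)); D35 (the marker's laws live in the pen's `TupleKitLaws`).  Definition lane (one `Type`-valued
def, three `Prop`-predicates, one data def, explicit header binders) + proof-lane theorems; box-before-file (REF1); `--supports stmt-HodgeConjecture-24833 --as helper`.  No instance, no notation,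
no named fact, no `sorry`.
HONEST LABEL: HC_CM is proved only modulo the printed citations until rung 0 closes; this file proves no printed statement.

THE REPAIR (C′ = ref1's «TYPE-HOMOGENEOUS», REF1's structured `Π_a ⊔ (Π_e ⊔ Π_s)` read through a marker).  Print's local index `Π′(G_v) = Π(G_v) ∪ {A-packets Π(ξ_v)}` (p. 199 ¶2) has TWO
SORTS of tokens — L-packets and A-packets — and its global `Π(G)` (p. 201 ll. 16–18, p. 202 l. 16 «disjoint union of `Π_s`, `Π_e`, `Π_a`») consists of families of ONE sort: `Π(ξ) = ⊗_v Π(ξ_v)`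
(all A), `Π(ρ) = ⊗_v ξ_H(ρ_v)` and the stable cuspidal `Π` (all L).  The literal p. 201 l. 10 reading «choose `Π_v ∈ Π′(G_v)` …, discrete if SOME member occurs discretely» (★ 3a `GlobalPacket` +
`IsDiscrete`, hence ★ `SpectralPacketG` ∕ ★ 3v `CohPacketG`) also admits MIXED families such as `Π(ξ)[w ↦ ξ_H(St_H(ξ_w))]` (discrete through `πˢ(ξ_w) ∈ Π(ξ_w) ∩ ξ_H(St_H(ξ_w))`, the ONLY
overlaps between the two sorts, p. 199 l. −2) — o384-1.  The junction therefore carries the sort as a DATUM `aTok v : Set (𝔩 v).Pkt` («the A-packet tokens at `v`»; its print laws — `Π(ξ)_v ∈ aTok v`,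
no non-A token contains `πⁿ(ξ_v)`, A-tokens meeting `Π(ξ_v)` equal it, tokens extensional — are clauses of the pen's `TupleKitLaws`, desk D35 (2)), and the tuple's packet type becomes
**`HomogPacketG 𝔩 𝔞 μ infOf aTok := {Q : SpectralPacketG 𝔩 𝔞 μ // Q.inf = infOf Q.fin ∧ Q.fin.IsHomogeneous aTok}`**, `IsHomogeneous aTok Π_f := (∀ v, Π_v ∈ aTok v) ∨ (∀ v, Π_v ∉ aTok v)`
(≅ print's `Π(G)`: `Π_a` = the all-A component, `Π_e ⊔ Π_s` = the all-L component).  REF1 m08 (n8-2): (i) the hybrid `swapAt (Π(ξ)).fin w P₂` with `P₂ ∉ aTok w` is NOT homogeneous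
(`IsHomogeneous.mem_iff`: membership in `aTok` is constant along a homogeneous family) — it does not inhabit `HomogPacketG`; an A-marked swap `P₂ ∈ aTok w`, `P₂ ≠ Π(ξ)_w` is killed by (L1″) exactly as
print kills it (a discrete `π` with `π_v = πⁿ(ξ_v)` a.e. lies in `Π(ξ)`, Thm. 13.3.6 (c), and distinct A-packets are disjoint, p. 199); (ii) `Π(ξ)` inhabits it (`piXiHm`, all-A by the shape) and every
★ theorem about `Q : SpectralPacketG` applies to `Q.1`; (iii) (L1″) `XiRigidityGHom` = Thm. 13.3.5 + 13.3.6 (c) on the homogeneous coherent packets.  ★ 3v `CohPacketG`∕(L1′) stay as ★ names.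

CONTENTS.
* §1 (w1) **`GlobalPacket.IsHomogeneous aTok Π_f : Prop`**, `IsHomogeneous.mem_iff`, `isHomogeneous_of_forall_mem`, `not_isHomogeneous_of_mem_of_not_mem` ((n8-2) (i)).
* §2 (w2) **`SpectralPacketG.HomogPacketG 𝔩 𝔞 μ infOf aTok`** (the tuple's `PG`), `HomogPacketG.toCoh` (forget homogeneity: a ★ 3v `CohPacketG`).
* §3 (w3) **`SpectralPacketG.XiPacketsSignedHom 𝔩 𝔞 μ infOf aTok Pk PkInf κ : Prop := ∀ ξ, ∃ Q, Q.inf = infOf Q.fin ∧ (∀ v, Q.fin.loc v ∈ aTok v) ∧ Q.IsSignedPacketOf (Pk ξ) (PkInf ξ) (κ ξ)`**,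
  `.toCoh`, **`piXiHm h ξ : HomogPacketG …`**, read-backs (`piXiHm_isSignedPacketOf`, `piXiHm_inf_eq`, `piXiHm_mem_aTok`, `piXiHm_isHomogeneous`, `piXiHm_containsAPacket`).
* §4 (w4) **(L1″) `SpectralPacketG.XiRigidityGHom h ψ νG tXi : Prop`** [Thm. 13.3.5 + 13.3.6 (c)], `germSubtype_val_eq_piXiHm`, **`tsum_germ_eq_half_mul_piXiHm`** — the (P2) `G`-germ sum over the
  HOMOGENEOUS index type `{Q : HomogPacketG … // germ S (evpG Q.1) = germ S (t ξ) ∧ ramG Q.1 ⊆ S}` [(14.6.2)–(14.6.3); `n(Π(ξ)) = ½`, Thm. 13.3.7].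

References: [Rogawski1990] §13.3 p. 201 ll. 10–18, p. 202 l. 16, Thm. 13.3.5 p. 202, Thm. 13.3.6 (b)(c) p. 202, Thm. 13.3.7 pp. 202–203, p. 199 ¶2 and l. −2; §13.1 Prop. 13.1.3 (d) p. 199;
§13.2 p. 200 l. 1–3; §14.4 Prop. 14.4.1 (a) p. 235; §14.6 (14.6.1) p. 240, (14.6.2) p. 241, (14.6.3) p. 243.
-/

set_option autoImplicit false
-- the mandated namespace repeats `HodgeConjecture.HodgeConjecture`, as in every `Theorems/*.lean` of this sub-problem
set_option linter.dupNamespace false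

noncomputable section

open NumberField IsDedekindDomain MeasureTheory Filter
open scoped Matrix MatrixGroups

open Literature.NumberTheory Literature.NumberTheory.Automorphic Literature.NumberTheory.Automorphic.UnitaryGroup
open Literature.NumberTheory.Rogawski1990 Literature.NumberTheory.GaloisRepresentations
open Literature.RepresentationTheory.BorelWallach2000 Literature.RepresentationTheory.KonnoKonno2007
open Summit.HodgeConjecture.HodgeConjecture.Cruxes.H413.F0P3InnerFormClassificationV6 (TestG splitForm EvpData EqOff germ germ_eq_germ_iff)
open Summit.HodgeConjecture.HodgeConjecture.Cruxes.H413.F0P3LocalPacketKit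
open Summit.HodgeConjecture.HodgeConjecture.Cruxes.H413.F0P3ArchPacketKit

/-! ## §1 (w1) Homogeneous finite-place families [p. 201 ll. 16–18; p. 202 l. 16; p. 199 l. −2] -/

namespace Summit.HodgeConjecture.HodgeConjecture.Cruxes.H413.F0P3GlobalPacket.GlobalPacket

variable {L : Type} [Field L] [NumberField L] [IsCMField L] {H' : Matrix (Fin 3) (Fin 3) L}
  {𝔩 : ∀ v : HeightOneSpectrum (𝓞 ↥(maximalRealSubfield L)), LocalPacketKit L H' v}

/-- **(w1) `Π_f.IsHomogeneous aTok`** — the finite-place family `Π_f = (Π_v)_v` is OF ONE SORT for the marker `aTok v ⊆ Π′(G_v)` («the A-packet tokens»): either every `Π_v` is an A-token, or none is.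
Print's `Π(G) = Π_a ⊔ Π_e ⊔ Π_s` (p. 201 ll. 16–18; p. 202 l. 16): `Π(ξ) = ⊗ Π(ξ_v)` all A; `Π(ρ) = ⊗ ξ_H(ρ_v)` and the stable cuspidal packets all L. [cite: Rogawski1990, §13.3 p. 201 ll. 16–18, p. 202 l. 16; §13.1 p. 199 ¶2] -/
def IsHomogeneous (aTok : ∀ v : HeightOneSpectrum (𝓞 ↥(maximalRealSubfield L)), Set (𝔩 v).Pkt) (Pg : GlobalPacket 𝔩) : Prop :=
  (∀ v, Pg.loc v ∈ aTok v) ∨ ∀ v, Pg.loc v ∉ aTok v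

variable {aTok : ∀ v : HeightOneSpectrum (𝓞 ↥(maximalRealSubfield L)), Set (𝔩 v).Pkt} {Pg : GlobalPacket 𝔩}

/-- Unfolding of (w1). [cite: Rogawski1990, §13.3 p. 201 ll. 16–18] -/
theorem isHomogeneous_iff : Pg.IsHomogeneous aTok ↔ (∀ v, Pg.loc v ∈ aTok v) ∨ ∀ v, Pg.loc v ∉ aTok v :=
  Iff.rfl

/-- Along a homogeneous family, membership in the marker is the same at any two places. [cite: Rogawski1990, §13.3 p. 201 ll. 16–18] -/
theorem IsHomogeneous.mem_iff (h : Pg.IsHomogeneous aTok) (v w : HeightOneSpectrum (𝓞 ↥(maximalRealSubfield L))) : Pg.loc v ∈ aTok v ↔ Pg.loc w ∈ aTok w := by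
  rcases h with h | h
  · exact ⟨fun _ => h w, fun _ => h v⟩
  · exact ⟨fun hv => absurd hv (h v), fun hw => absurd hw (h w)⟩

/-- An all-A family is homogeneous (the case of `Π(ξ)`). [cite: Rogawski1990, §13.3 p. 201 l. 16] -/
theorem isHomogeneous_of_forall_mem (h : ∀ v, Pg.loc v ∈ aTok v) : Pg.IsHomogeneous aTok :=
  Or.inl h

/-- An all-L family is homogeneous (the case of `Π(ρ)`, `Π` stable). [cite: Rogawski1990, §13.3 p. 201 ll. 17–18] -/
theorem isHomogeneous_of_forall_not_mem (h : ∀ v, Pg.loc v ∉ aTok v) : Pg.IsHomogeneous aTok :=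
  Or.inr h

/-- **REF1 m08 (n8-2) (i)**: a family that is an A-token at one place and a non-A token at another (the o384-1 hybrid `Π(ξ)[w ↦ ξ_H(St_H(ξ_w))]`) is NOT homogeneous. [cite: Rogawski1990, §13.1 p. 199 l. −2; §13.3 p. 202 l. 16] -/
theorem not_isHomogeneous_of_mem_of_not_mem {v w : HeightOneSpectrum (𝓞 ↥(maximalRealSubfield L))} (hv : Pg.loc v ∈ aTok v) (hw : Pg.loc w ∉ aTok w) :
    ¬ Pg.IsHomogeneous aTok :=
  fun h => hw ((h.mem_iff v w).1 hv)

end Summit.HodgeConjecture.HodgeConjecture.Cruxes.H413.F0P3GlobalPacket.GlobalPacket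

namespace Summit.HodgeConjecture.HodgeConjecture.Cruxes.H413.F0P3SpectralPacket.SpectralPacketG

open Summit.HodgeConjecture.HodgeConjecture.Cruxes.H413.F0P3GlobalPacket

/-! ## §2 (w2) The homogeneous coherent packet type [p. 201 ll. 16–18; Thm. 13.3.5] -/

section Homog

variable {L : Type} [Field L] [NumberField L] [IsCMField L] {H' : Matrix (Fin 3) (Fin 3) L}

/-- **(w2) `HomogPacketG 𝔩 𝔞 μ infOf aTok` — THE TUPLE'S `PG`: COHERENT, TYPE-HOMOGENEOUS DISCRETE `G`-PACKETS** `Q = (Π_f, Π_∞)` with `Π_∞ = infOf Π_f` (★ 3v coherence, Thm. 13.3.5) and `Π_f` of one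
sort for the A-marker `aTok` ((w1)).  In bijection with print's `Π(G) = Π_a ⊔ Π_e ⊔ Π_s` (p. 201 ll. 16–18) at a print-faithful kit: the all-A component is `{Π(ξ)}`, the all-L component the endoscopic
and stable discrete L-packets; the o384-1 hybrids are excluded ((w1) `not_isHomogeneous_of_mem_of_not_mem`). [cite: Rogawski1990, §13.3 p. 201 ll. 10–18, p. 202 l. 16, Thm. 13.3.5 p. 202; §14.6 (14.6.1) p. 240] -/
def HomogPacketG (𝔩 : ∀ v : HeightOneSpectrum (𝓞 ↥(maximalRealSubfield L)), LocalPacketKit L H' v) (𝔞 : ArchPacketKit)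
    (μ : Measure (adelicGroupData (↥(maximalRealSubfield L)) L (IsCMField.complexConj L) 3 H').automorphicQuotient)
    [SMulInvariantMeasure (adelicGroupData (↥(maximalRealSubfield L)) L (IsCMField.complexConj L) 3 H').Adelic
      (adelicGroupData (↥(maximalRealSubfield L)) L (IsCMField.complexConj L) 3 H').automorphicQuotient μ]
    (infOf : GlobalPacket 𝔩 → 𝔞.PktInf) (aTok : ∀ v : HeightOneSpectrum (𝓞 ↥(maximalRealSubfield L)), Set (𝔩 v).Pkt) : Type :=
  {Q : SpectralPacketG 𝔩 𝔞 μ // Q.inf = infOf Q.fin ∧ Q.fin.IsHomogeneous aTok}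

variable {𝔩 : ∀ v : HeightOneSpectrum (𝓞 ↥(maximalRealSubfield L)), LocalPacketKit L H' v} {𝔞 : ArchPacketKit}
  {μ : Measure (adelicGroupData (↥(maximalRealSubfield L)) L (IsCMField.complexConj L) 3 H').automorphicQuotient}
  [SMulInvariantMeasure (adelicGroupData (↥(maximalRealSubfield L)) L (IsCMField.complexConj L) 3 H').Adelic
    (adelicGroupData (↥(maximalRealSubfield L)) L (IsCMField.complexConj L) 3 H').automorphicQuotient μ]
  {infOf : GlobalPacket 𝔩 → 𝔞.PktInf} {aTok : ∀ v : HeightOneSpectrum (𝓞 ↥(maximalRealSubfield L)), Set (𝔩 v).Pkt}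

/-- Forgetting homogeneity: a homogeneous coherent packet is a ★ 3v coherent packet (REF1 m08 (n8-2) (ii): the ★ facts on `.1` carry over). [cite: Rogawski1990, §13.3 Thm. 13.3.5 p. 202] -/
def HomogPacketG.toCoh (Q : HomogPacketG 𝔩 𝔞 μ infOf aTok) : CohPacketG 𝔩 𝔞 μ infOf :=
  ⟨Q.1, Q.2.1⟩

/-- `Q.toCoh.1 = Q.1`. [cite: Rogawski1990, §13.3 Thm. 13.3.5 p. 202] -/
theorem HomogPacketG.toCoh_val (Q : HomogPacketG 𝔩 𝔞 μ infOf aTok) : Q.toCoh.1 = Q.1 :=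
  rfl

/-- Coherence of a homogeneous coherent packet. [cite: Rogawski1990, §13.3 Thm. 13.3.5 p. 202] -/
theorem HomogPacketG.inf_eq (Q : HomogPacketG 𝔩 𝔞 μ infOf aTok) : Q.1.inf = infOf Q.1.fin :=
  Q.2.1

/-- Homogeneity of a homogeneous coherent packet. [cite: Rogawski1990, §13.3 p. 201 ll. 16–18] -/
theorem HomogPacketG.isHomogeneous (Q : HomogPacketG 𝔩 𝔞 μ infOf aTok) : Q.1.fin.IsHomogeneous aTok :=
  Q.2.2

end Homog

/-! ## §3 (w3) The A-marked coherent signed ξ-shape and the slot `PiXi` [Thm. 13.3.6 (b); §13.2 p. 200 l. 1–3; Prop. 14.4.1 (a); p. 199 ¶2] -/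

section Shape

variable {L : Type} [Field L] [NumberField L] [IsCMField L] {H' : Matrix (Fin 3) (Fin 3) L}
  {𝔩 : ∀ v : HeightOneSpectrum (𝓞 ↥(maximalRealSubfield L)), LocalPacketKit L H' v} {𝔞 : ArchPacketKit}
  {μ : Measure (adelicGroupData (↥(maximalRealSubfield L)) L (IsCMField.complexConj L) 3 H').automorphicQuotient}
  [SMulInvariantMeasure (adelicGroupData (↥(maximalRealSubfield L)) L (IsCMField.complexConj L) 3 H').Adelic
    (adelicGroupData (↥(maximalRealSubfield L)) L (IsCMField.complexConj L) 3 H').automorphicQuotient μ]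

/-- **(w3) `XiPacketsSignedHom 𝔩 𝔞 μ infOf aTok Pk PkInf κ`** — ★ 3v `XiPacketsSignedCoh` WITH THE SORT: for every one-dimensional automorphic `ξ` there is a discrete packet `Q` with coherent
archimedean coordinate (`Q.inf = infOf Q.fin`, Thm. 13.3.5), ALL OF WHOSE LOCAL TOKENS ARE A-TOKENS (`Q.fin.loc v ∈ aTok v` — `Π(ξ)_v = Π(ξ_v)` IS the A-packet of `ξ_v`, p. 199 ¶2, §12.2), which is
the signed packet of `(Pk ξ, PkInf ξ, κ ξ)` (★ `IsSignedPacketOf`: members `{πⁿ} ∪ πˢ`, `⟨1,πⁿ⟩ = 1`, `⟨1,πˢ⟩ = −1` [§13.2 p. 200 l. 1–3], archimedean signs × `κ ξ` [Prop. 14.4.1 (a)]); discrete by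
Thm. 13.3.6 (b).  The junction input `hXiSH` of «K9STF ⟸ TUPLE» at `PG := HomogPacketG …`. [cite: Rogawski1990, §13.3 Thm. 13.3.6 (b) p. 202, Thm. 13.3.5 p. 202, p. 199 ¶2; §13.2 p. 200 l. 1–3; §14.4 Prop. 14.4.1 (a) p. 235] -/
def XiPacketsSignedHom (𝔩 : ∀ v : HeightOneSpectrum (𝓞 ↥(maximalRealSubfield L)), LocalPacketKit L H' v) (𝔞 : ArchPacketKit)
    (μ : Measure (adelicGroupData (↥(maximalRealSubfield L)) L (IsCMField.complexConj L) 3 H').automorphicQuotient)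
    [SMulInvariantMeasure (adelicGroupData (↥(maximalRealSubfield L)) L (IsCMField.complexConj L) 3 H').Adelic
      (adelicGroupData (↥(maximalRealSubfield L)) L (IsCMField.complexConj L) 3 H').automorphicQuotient μ]
    (infOf : GlobalPacket 𝔩 → 𝔞.PktInf) (aTok : ∀ v : HeightOneSpectrum (𝓞 ↥(maximalRealSubfield L)), Set (𝔩 v).Pkt)
    (Pk : OneDimAutRepH L → ∀ v : HeightOneSpectrum (𝓞 ↥(maximalRealSubfield L)), CMLocalAPacket L H' v)
    (PkInf : OneDimAutRepH L → LocalAPacket (GKIrrClass (uFormGroup (Fin 2) (Fin 1)))) (κ : OneDimAutRepH L → ℤ) : Prop :=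
  ∀ ξ : OneDimAutRepH L, ∃ Q : SpectralPacketG 𝔩 𝔞 μ, Q.inf = infOf Q.fin ∧ (∀ v, Q.fin.loc v ∈ aTok v) ∧ Q.IsSignedPacketOf (Pk ξ) (PkInf ξ) (κ ξ)

variable {infOf : GlobalPacket 𝔩 → 𝔞.PktInf} {aTok : ∀ v : HeightOneSpectrum (𝓞 ↥(maximalRealSubfield L)), Set (𝔩 v).Pkt}
  {PkX : OneDimAutRepH L → ∀ v : HeightOneSpectrum (𝓞 ↥(maximalRealSubfield L)), CMLocalAPacket L H' v}
  {PkInfX : OneDimAutRepH L → LocalAPacket (GKIrrClass (uFormGroup (Fin 2) (Fin 1)))} {κX : OneDimAutRepH L → ℤ}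

/-- Unfolding of (w3). [cite: Rogawski1990, §13.3 Thm. 13.3.6 (b) p. 202] -/
theorem xiPacketsSignedHom_iff :
    XiPacketsSignedHom 𝔩 𝔞 μ infOf aTok PkX PkInfX κX ↔
      ∀ ξ : OneDimAutRepH L, ∃ Q : SpectralPacketG 𝔩 𝔞 μ, Q.inf = infOf Q.fin ∧ (∀ v, Q.fin.loc v ∈ aTok v) ∧ Q.IsSignedPacketOf (PkX ξ) (PkInfX ξ) (κX ξ) :=
  Iff.rfl

/-- The A-marked shape implies ★ 3v's coherent shape (forgetting the sort; bookkeeping). [cite: Rogawski1990, §13.3 Thm. 13.3.6 (b) p. 202] -/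
theorem XiPacketsSignedHom.toCoh (h : XiPacketsSignedHom 𝔩 𝔞 μ infOf aTok PkX PkInfX κX) : XiPacketsSignedCoh 𝔩 𝔞 μ infOf PkX PkInfX κX :=
  fun ξ => (h ξ).imp fun _ hQ => ⟨hQ.1, hQ.2.2⟩

/-- **(w3′) `piXiHm h ξ : HomogPacketG …` — THE TUPLE'S `PiXi ξ = Π(ξ)` as a HOMOGENEOUS COHERENT packet** (a choice of witness; all-A). [cite: Rogawski1990, §13.3 Thm. 13.3.6 (b), Thm. 13.3.5 p. 202, p. 201 l. 16] -/
def piXiHm (h : XiPacketsSignedHom 𝔩 𝔞 μ infOf aTok PkX PkInfX κX) (ξ : OneDimAutRepH L) : HomogPacketG 𝔩 𝔞 μ infOf aTok :=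
  ⟨(h ξ).choose, (h ξ).choose_spec.1, GlobalPacket.isHomogeneous_of_forall_mem (h ξ).choose_spec.2.1⟩

/-- `(piXiHm h ξ).1` IS the signed packet of `(Pk ξ, PkInf ξ, κ ξ)`. [cite: Rogawski1990, §13.2 p. 200 l. 1–3; §13.1 Prop. 13.1.3 (d) p. 199] -/
theorem piXiHm_isSignedPacketOf (h : XiPacketsSignedHom 𝔩 𝔞 μ infOf aTok PkX PkInfX κX) (ξ : OneDimAutRepH L) :
    (piXiHm h ξ).1.IsSignedPacketOf (PkX ξ) (PkInfX ξ) (κX ξ) :=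
  (h ξ).choose_spec.2.2

/-- Coherence of the witness: `(piXiHm h ξ).1.inf = infOf (piXiHm h ξ).1.fin` (distinct from ★ `piXiC_inf_eq`: Hom-level read-back about the `piXiHm` witness). [cite: Rogawski1990, §13.3 Thm. 13.3.5 p. 202] -/
theorem piXiHm_inf_eq (h : XiPacketsSignedHom 𝔩 𝔞 μ infOf aTok PkX PkInfX κX) (ξ : OneDimAutRepH L) : (piXiHm h ξ).1.inf = infOf (piXiHm h ξ).1.fin :=
  (piXiHm h ξ).2.1

/-- Every local token of `Π(ξ)` is an A-token. [cite: Rogawski1990, §13.1 p. 199 ¶2; §13.3 p. 201 l. 16] -/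
theorem piXiHm_mem_aTok (h : XiPacketsSignedHom 𝔩 𝔞 μ infOf aTok PkX PkInfX κX) (ξ : OneDimAutRepH L) (v : HeightOneSpectrum (𝓞 ↥(maximalRealSubfield L))) :
    (piXiHm h ξ).1.fin.loc v ∈ aTok v :=
  (h ξ).choose_spec.2.1 v

/-- `Π(ξ)_f` is homogeneous (all-A). [cite: Rogawski1990, §13.3 p. 201 l. 16] -/
theorem piXiHm_isHomogeneous (h : XiPacketsSignedHom 𝔩 𝔞 μ infOf aTok PkX PkInfX κX) (ξ : OneDimAutRepH L) : (piXiHm h ξ).1.fin.IsHomogeneous aTok :=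
  (piXiHm h ξ).2.2

/-- The finite components of `Π(ξ)` contain the A-packets (★ (ℓ6) `ContainsAPacket`) — BY NAME of ★ 3v `piXiC_containsAPacket` through `toCoh` (read-back symmetry; U597). [cite: Rogawski1990, §13.1 Prop. 13.1.3 (d) p. 199] -/
theorem piXiHm_containsAPacket (h : XiPacketsSignedHom 𝔩 𝔞 μ infOf aTok PkX PkInfX κX) (ξ : OneDimAutRepH L) (v : HeightOneSpectrum (𝓞 ↥(maximalRealSubfield L))) :
    (𝔩 v).ContainsAPacket (PkX ξ v) :=
  piXiC_containsAPacket h.toCoh ξ v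

end Shape

/-! ## §4 (w4) (L1″) Rigidity on the homogeneous coherent packets and the `G`-germ sum [Thm. 13.3.5, 13.3.6 (c); (14.6.2)–(14.6.3); Thm. 13.3.7] -/

section Rigidity

variable {L : Type} [Field L] [NumberField L] [IsCMField L] {H : Matrix (Fin 3) (Fin 3) L}
  {𝔩 : ∀ v : HeightOneSpectrum (𝓞 ↥(maximalRealSubfield L)), LocalPacketKit L (splitForm L 3) v} {𝔞 : ArchPacketKit}
  {μ : Measure (adelicGroupData (↥(maximalRealSubfield L)) L (IsCMField.complexConj L) 3 (splitForm L 3)).automorphicQuotient}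
  [SMulInvariantMeasure (adelicGroupData (↥(maximalRealSubfield L)) L (IsCMField.complexConj L) 3 (splitForm L 3)).Adelic
    (adelicGroupData (↥(maximalRealSubfield L)) L (IsCMField.complexConj L) 3 (splitForm L 3)).automorphicQuotient μ]
  {infOf : GlobalPacket 𝔩 → 𝔞.PktInf} {aTok : ∀ v : HeightOneSpectrum (𝓞 ↥(maximalRealSubfield L)), Set (𝔩 v).Pkt}
  {Pk : OneDimAutRepH L → ∀ v : HeightOneSpectrum (𝓞 ↥(maximalRealSubfield L)), CMLocalAPacket L (splitForm L 3) v}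
  {PkInf : OneDimAutRepH L → LocalAPacket (GKIrrClass (uFormGroup (Fin 2) (Fin 1)))} {κ : OneDimAutRepH L → ℤ}

/-- **(L1″) `XiRigidityGHom h ψ νG tXi` — RIGIDITY FOR `Π(ξ)` ON THE HOMOGENEOUS COHERENT PACKETS (named law)**: a discrete `G`-packet `Q` with coherent archimedean coordinate (`Q.inf = infOf Q.fin`)
and finite part OF ONE SORT (`Q.fin.IsHomogeneous aTok`) whose e.v.p. slot agrees with the record `t(ξ)` off a finite `S ⊇ ramG Q` IS `Π(ξ) = (piXiHm h ξ).1`.  Print: an all-A such `Q` has the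
unramified member `πⁿ(ξ_v)` off `S`, so its discrete member lies in `Π(ξ)` [Thm. 13.3.6 (c)] and its A-tokens meet, hence equal, the `Π(ξ_v)` [p. 199: distinct A-packets are disjoint]; an all-L `Q`
would put `πⁿ(ξ_v)` in an L-packet [p. 199 ¶2: it lies in none]; uniqueness of `Π` with given e.v.p. is Thm. 13.3.5 ∕ (14.6.2) «`Π` is unique».  Unlike ★ 3v (L1′) (o384-1: over `CohPacketG` the law
denies discreteness to the print-discrete hybrid `Π(ξ)[w ↦ ξ_H(St_H(ξ_w))]`), the homogeneity antecedent excludes the hybrids.  A junction hypothesis (letter PK-A content).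
[cite: Rogawski1990, §13.3 Thm. 13.3.5 p. 202, Thm. 13.3.6 (c) p. 202, p. 199 ¶2; §14.6 (14.6.2) p. 241, (14.6.3) p. 243] -/
def XiRigidityGHom (h : XiPacketsSignedHom 𝔩 𝔞 μ infOf aTok Pk PkInf κ)
    (ψ : ∀ v : HeightOneSpectrum (𝓞 ↥(maximalRealSubfield L)), (cmDatum L 3 H).Local v ≃ₜ* (cmDatum L 3 (splitForm L 3)).Local v)
    [∀ v : HeightOneSpectrum (𝓞 ↥(maximalRealSubfield L)), MeasurableSpace ((cmDatum L 3 (splitForm L 3)).Local v)]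
    (νG : ∀ v : HeightOneSpectrum (𝓞 ↥(maximalRealSubfield L)), Measure ((cmDatum L 3 (splitForm L 3)).Local v))
    (tXi : OneDimAutRepH L → EvpData L H) : Prop :=
  ∀ (ξ : OneDimAutRepH L) (S : Finset (HeightOneSpectrum (𝓞 ↥(maximalRealSubfield L)))) (Q : SpectralPacketG 𝔩 𝔞 μ),
    Q.inf = infOf Q.fin → Q.fin.IsHomogeneous aTok → EqOff L H S (Q.evpGψ ψ νG) (tXi ξ) → Q.fin.ramFinset ⊆ S → Q = (piXiHm h ξ).1

variable {h : XiPacketsSignedHom 𝔩 𝔞 μ infOf aTok Pk PkInf κ}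
  {ψ : ∀ v : HeightOneSpectrum (𝓞 ↥(maximalRealSubfield L)), (cmDatum L 3 H).Local v ≃ₜ* (cmDatum L 3 (splitForm L 3)).Local v}
  [∀ v : HeightOneSpectrum (𝓞 ↥(maximalRealSubfield L)), MeasurableSpace ((cmDatum L 3 (splitForm L 3)).Local v)]
  {νG : ∀ v : HeightOneSpectrum (𝓞 ↥(maximalRealSubfield L)), Measure ((cmDatum L 3 (splitForm L 3)).Local v)}
  {tXi : OneDimAutRepH L → EvpData L H}

/-- **(w4a) THE HOMOGENEOUS `G`-INDEX TYPE OF (P2) IS `Π(ξ)` ALONE**: under (L1″), every element of `{Q : HomogPacketG … // germ S (evpG Q.1) = germ S (t ξ) ∧ ramG Q.1 ⊆ S}` is `piXiHm h ξ`.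
[cite: Rogawski1990, §13.3 Thm. 13.3.5 p. 202; §14.6 (14.6.2) p. 241] -/
theorem germSubtype_val_eq_piXiHm (hrig : XiRigidityGHom h ψ νG tXi) (ξ : OneDimAutRepH L) (S : Finset (HeightOneSpectrum (𝓞 ↥(maximalRealSubfield L))))
    (Q : {Q : HomogPacketG 𝔩 𝔞 μ infOf aTok // germ L H S (Q.1.evpGψ ψ νG) = germ L H S (tXi ξ) ∧ Q.1.fin.ramFinset ⊆ S}) : Q.1 = piXiHm h ξ :=
  Subtype.ext (hrig ξ S Q.1.1 Q.1.2.1 Q.1.2.2 ((germ_eq_germ_iff L H S _ _).1 Q.2.1) Q.2.2)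

/-- **(w4b) THE `G`-GERM SUM OF (P2) AT THE HOMOGENEOUS TUPLE — «`Σ_{Q : t(Q) = t(ξ) off S, ramG Q ⊆ S} n(Q) · Tr Q_S(f′_S) = ½ · Tr Π(ξ)_S(f′_S)`»** [(14.6.2)–(14.6.3)]: under (L1″), the (P2a)
facts for `Π(ξ)` and `n(Π(ξ)) = ½` [Thm. 13.3.7; `Card(Π̂(ξ)) = 2`, p. 203], for ANY slots `nG`, `trGS` on the homogeneous coherent packets with `nG (piXiHm h ξ) = ½`.
[cite: Rogawski1990, §14.6 (14.6.2) p. 241, (14.6.3) p. 243; §13.3 Thm. 13.3.5, Thm. 13.3.7 pp. 202–203] -/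
theorem tsum_germ_eq_half_mul_piXiHm (hrig : XiRigidityGHom h ψ νG tXi) (ξ : OneDimAutRepH L) (S : Finset (HeightOneSpectrum (𝓞 ↥(maximalRealSubfield L))))
    (hevpG : EqOff L H S ((piXiHm h ξ).1.evpGψ ψ νG) (tXi ξ)) (hramG : (piXiHm h ξ).1.fin.ramFinset ⊆ S)
    (nG : HomogPacketG 𝔩 𝔞 μ infOf aTok → ℂ) (hnG : nG (piXiHm h ξ) = 1 / 2) {X : Type} (trGS : HomogPacketG 𝔩 𝔞 μ infOf aTok → X → ℂ) (fSG : X) :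
    (∑' Q : {Q : HomogPacketG 𝔩 𝔞 μ infOf aTok // germ L H S (Q.1.evpGψ ψ νG) = germ L H S (tXi ξ) ∧ Q.1.fin.ramFinset ⊆ S}, nG Q.1 * trGS Q.1 fSG)
      = (1 / 2 : ℂ) * trGS (piXiHm h ξ) fSG := by
  let a : {Q : HomogPacketG 𝔩 𝔞 μ infOf aTok // germ L H S (Q.1.evpGψ ψ νG) = germ L H S (tXi ξ) ∧ Q.1.fin.ramFinset ⊆ S} :=
    ⟨piXiHm h ξ, (germ_eq_germ_iff L H S _ _).2 hevpG, hramG⟩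
  rw [tsum_eq_single a (fun Q hQ => absurd (Subtype.ext ((germSubtype_val_eq_piXiHm hrig ξ S Q).trans (germSubtype_val_eq_piXiHm hrig ξ S a).symm)) hQ)]
  change nG (piXiHm h ξ) * trGS (piXiHm h ξ) fSG = _
  rw [hnG]

end Rigidity

end Summit.HodgeConjecture.HodgeConjecture.Cruxes.H413.F0P3SpectralPacket.SpectralPacketG

end
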